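import Literature.AlgebraicGeometry.Motives.AlbaneseExistenceSubfieldComplex
import HarnessLib

/-!
# A generating pointed morphism `X → B` bounds `dim B` by the dimension of the Albanese (Jacobian) of `X`

Topic `Literature/AlgebraicGeometry/Motives`, namespace `Literature.AlgebraicGeometry.Motives`.  Cell `hodgecm-mathlib`
(D-0151), row III-0 (`Liu2021.albanese_bettiOne_pullback_bijective`), A-p14's road memo `ROAD-III0-albanese-baseChange.md`
steps (S6)–(S7), the TAIL of the assembly F5 (the dimension inequality (R-bc) `dim J(Y_ℂ) ≤ dim J(Y_k)` is obtained by
GENERATING an abelian variety of dimension `dim J(Y_ℂ)` at a finite Galois level `L/k` and bounding it there).  PROVED here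
(theorems only; no definition, no named fact):

* `Jacobian.dim_le_of_generates` — Serre's remark «`h` est nécessairement surjectif, puisque `f′` engendre `A′`»: for ANY
  Jacobian (Albanese) datum `𝒥` of `Y` over a field `K`, a point `P ∈ Y(K)` and a pointed morphism `F : Y → B` which
  GENERATES the abelian variety `B`, the pointed factorisation `u : J(Y) → B` of `F` (`Jacobian.descPointed`) is surjective
  (`Generates.surjective_of_comp_eq`), so `dim B ≤ dim J(Y)` (`AbelianVariety.dim_le_of_surjective`);
* `Jacobian.dim_le_of_generates_baseChange` — the GALOIS-LEVEL form: `X` smooth projective over `k ⊆ ℂ` with a Jacobian `𝒥` over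
  `k`, `L/k` finite Galois inside `ℂ`, `P ∈ X(L)`, `F : X_L → B` pointed and generating ⇒ `dim B ≤ dim J(X)`: the Jacobian of
  `X_L` exists (`nonempty_jacobian_of_isSmoothProjective_of_algPoints_of_algebra_complex`, `IsSmoothProjective.baseChange_obj`),
  bounds `dim B` by the previous lemma, and has the dimension of `J(X)` by Galois descent (A-p14's
  `Jacobian.exists_jacobian_nonempty_iso_baseChange`, `AbelianVariety.dim_baseChange`, `Jacobian.uniqueUpToIso`).

## References
* [Serre1958MorphismesUniversels] J.-P. Serre, *Morphismes universels et variété d'Albanese*, Sém. Chevalley 1958/59, exp. 10,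
  no. 2 (proof of Thm. 2).
* [Milne1986JacobianVarieties] J. S. Milne, *Jacobian varieties*, in Cornell–Silverman (1986), §6 Prop. 6.1, Remark 1.9.
* [Lang1983AbelianVarieties] S. Lang, *Abelian Varieties*, II §3 (p. 35).
-/

noncomputable section

universe u

open CategoryTheory CategoryTheory.Limits AlgebraicGeometry MonoidalCategory CartesianMonoidalCategory

namespace Literature.AlgebraicGeometry.Motives

open scoped MonObj
open AbelianVariety (bcSpec bcFunctor)

/-- **A generating pointed morphism bounds the dimension by the Albanese dimension** (Serre, proof of Thm. 2: «`h` est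
nécessairement surjectif, puisque `f′` engendre `A′`»): for a Jacobian datum `𝒥` of `Y / K`, `P ∈ Y(K)` and
`F : Y → B` with `F(P) = 0` generating `B`, the factorisation `u : J(Y) → B` of `F` through the Abel–Jacobi map is
surjective, hence `dim B ≤ dim J(Y)`. [cite: Serre1958MorphismesUniversels, no. 2 (proof of Thm. 2)]
[cite: Milne1986JacobianVarieties, §6 Prop. 6.1] -/
theorem Jacobian.dim_le_of_generates {K : Type u} [Field K] {Y : SchemeOver K} (𝒥 : Jacobian Y)
    (P : AlgPoints Y K) {B : AbelianVariety K} (F : Y ⟶ B.X) (hF : P ≫ F = 1) (hgen : Generates F) :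
    B.dim ≤ 𝒥.J.dim := by
  haveI := hgen.surjective_of_comp_eq (𝒥.descPointed P F hF) (𝒥.abelJacobi_descPointed P F hF)
  exact AbelianVariety.dim_le_of_surjective (𝒥.descPointed P F hF)

/-- **Galois-level form**: `X` smooth projective over `k ⊆ ℂ` with a Jacobian `𝒥 / k`, `L / k` finite Galois inside `ℂ`
(`[Algebra L ℂ]`), `P ∈ X(L)`, and a pointed morphism `F : X_L → B` GENERATING the abelian variety `B / L`: then
`dim B ≤ dim J(X)`.  The Jacobian of `X_L` exists over `L ⊆ ℂ` (Serre's criterion, tree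
`nonempty_jacobian_of_isSmoothProjective_of_algPoints_of_algebra_complex`), bounds `dim B` (`Jacobian.dim_le_of_generates`), and
descends to `k` (`Jacobian.exists_jacobian_nonempty_iso_baseChange`), where all Jacobians of `X` are isomorphic
(`Jacobian.uniqueUpToIso`) and base change preserves dimension (`AbelianVariety.dim_baseChange`) — steps (S6)–(S7) of the
III-0 road. [cite: Serre1958MorphismesUniversels, no. 2 (proof of Thm. 2)] [cite: Milne1986JacobianVarieties, Remark 1.9 and §6 Prop. 6.4] -/
theorem Jacobian.dim_le_of_generates_baseChange {k : Type} [Field k] {L : Type} [Field L] [Algebra k L]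
    [FiniteDimensional k L] [IsGalois k L] [Algebra L ℂ] {d : ℕ} {X : SchemeOver k}
    (hX : IsSmoothProjective d X) (𝒥 : Jacobian X) (P : AlgPoints ((bcFunctor k L).obj X) L)
    {B : AbelianVariety L} (F : (bcFunctor k L).obj X ⟶ B.X) (hF : P ≫ F = 1) (hgen : Generates F) :
    B.dim ≤ 𝒥.J.dim := by
  -- the Jacobian of `X_L` over `L ⊆ ℂ`
  have hXL : IsSmoothProjective d ((bcFunctor k L).obj X) := hX.baseChange_obj (L := L)
  obtain ⟨𝒥L⟩ := nonempty_jacobian_of_isSmoothProjective_of_algPoints_of_algebra_complex ((bcFunctor k L).obj X) hXL P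
  -- `dim B ≤ dim J(X_L)`
  have h₁ : B.dim ≤ 𝒥L.J.dim := 𝒥L.dim_le_of_generates P F hF hgen
  -- `dim J(X_L) = dim J(X)` by Galois descent
  obtain ⟨𝒥₀, ⟨e⟩⟩ := Jacobian.exists_jacobian_nonempty_iso_baseChange hX L 𝒥L
  -- isomorphic abelian varieties have equal dimensions (an isomorphism is an isogeny)
  have hdim : ∀ {K' : Type} [Field K'] {A A' : AbelianVariety K'} (i : A ≅ A'), A.dim = A'.dim := by
    intro K' _ A A' i
    haveI : IsIso (AbelianVariety.Hom.toSchemeHom i.hom) :=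
      ⟨AbelianVariety.Hom.toSchemeHom i.inv,
        by rw [← AbelianVariety.toSchemeHom_comp, i.hom_inv_id]; rfl,
        by rw [← AbelianVariety.toSchemeHom_comp, i.inv_hom_id]; rfl⟩
    exact AbelianVariety.dim_eq_of_isIsogeny (f := i.hom) ⟨inferInstance, inferInstance⟩
  have h₂ : 𝒥L.J.dim = 𝒥.J.dim := by
    rw [hdim e, AbelianVariety.dim_baseChange, hdim (Jacobian.uniqueUpToIso 𝒥₀ 𝒥)]
  omega

end Literature.AlgebraicGeometry.Motives

end
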